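import Literature.NumberTheory.EllipticCurves.FormalGroupLawAddXEvalProofs
import Mathlib.RingTheory.MvPowerSeries.NoZeroDivisors
import HarnessLib

/-!
# The addition formula for `x` on the formal group, II: `x(u +_F v) + x(u -_F v)` as a formal
# identity in `ℚ_p⟦u, v⟧` (Blakestad–Grant 2023, Lemma 10, "readily from the group law" — proofs only)

Trunk T-NT-EC (Literature/NumberTheory/EllipticCurves). Pure proof file on the way to the formal
Mazur–Tate theta relation (named fact `WeierstrassCurve.padicSigma_theta_formal`,
`CanonicalPAdicHeightThetaProofs.lean`); continuation of `FormalGroupLawAddXEvalProofs.lean`.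

* `addX_identity_pointwise` — the pole-cleared addition formula, both sides multiplied by
  `t₁·t₂·Δ̂`, holds at every `(t₁, t₂)` of the open unit polydisc: write `(t₁, t₂) = (z(P), z(Q))`
  with `P, Q ∈ E₁(ℚ_p)` (`exists_isInReductionKernel_formalParameter_eq`); the factor
  `t₁·t₂·Δ̂ = z(P)³z(Q)³(x(Q) - x(P))` makes the cases `P = O`, `Q = O`, `x(P) = x(Q)` trivial,
  and otherwise it is `two_mul_sq_mul_addX_add_addX` transported through θ₃
  (`F̂(z(P), z(Q)) = z(P + Q)`, `F̂(z(P), î(z(Q))) = z(P - Q)`, `formalGroupLaw_padicEval_holds`)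
  and the dictionary `X̂(z(R)) = x(R)z(R)²`.
* `formalGroupLaw_addX_identity` — **the formal identity** in `ℚ_p⟦u, v⟧` for an elliptic
  curve with `p`-integral equation: with `X = z²x(z)`, `Ỹ = (a₁z - 2)X + a₃z³`,
  `Δ = u²X(v) - v²X(u)`, `F = u +_F v`, `Fm = u -_F v`,
  `2u²v²Δ²·(X(F)·Fm² + X(Fm)·F²) = F²Fm²·(Ỹ(u)²v⁶ + Ỹ(v)²u⁶ - (b₂u²v² + 4v²X(u) + 4u²X(v))·Δ²)`,
  i.e. `x(u +_F v) + x(u -_F v) = (Y(u)² + Y(v)²)/(2(x(u) - x(v))²) - b₂/2 - 2(x(u) + x(v))` with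
  all poles cleared: both sides times `u·v·Δ` agree on the polydisc, hence formally (identity
  theorem `eq_of_padicEvalMv_eq`), and `u·v·Δ ≠ 0` is cancelled in the domain `ℚ_p⟦u, v⟧`.

## Sources

* C. Blakestad, D. Grant, J. Number Theory 249 (2023) (arXiv:1903.02480), §3 Lemma 10, Prop. 14.
* J. H. Silverman, *AEC* 2nd ed. (2009), III.2.3, IV.1–2, VII.2.2.

## Design notes

Stated for `V/ℚ_p` elliptic with `[V.IsIntegral ℤ_[p]]` (where the identity theorem and θ₃
live). No definitions, no named facts.
-/

noncomputable section

open scoped Classical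
open PowerSeries Literature.NumberTheory.EllipticCurves

namespace WeierstrassCurve

/-! ### The identity at points of `E₁(ℚ_p) × E₁(ℚ_p)` -/

section Pointwise

variable {p : ℕ} [Fact p.Prime] {V : WeierstrassCurve ℚ_[p]} [hV : V.IsIntegral ℤ_[p]]
  [V.IsElliptic] {t₁ t₂ : ℚ_[p]}

/-- **The addition formula at a pair of parameters**, both sides multiplied by
`t₁·t₂·Δ̂` (`Δ̂ = t₁²X̂(t₂) - t₂²X̂(t₁) = z(P)²z(Q)²(x(Q) - x(P))`): for `(t₁, t₂) = (z(P), z(Q))`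
with `P, Q ∈ E₁(ℚ_p)` this is trivial if `P = O`, `Q = O` or `x(P) = x(Q)`, and otherwise it is
`two_mul_sq_mul_addX_add_addX` transported through θ₃ (`F̂(z(P), z(Q)) = z(P + Q)`,
`F̂(z(P), î(z(Q))) = z(P - Q)`) and the dictionary `X̂(z(R)) = x(R)z(R)²`.
[Blakestad–Grant 2023, Lemma 10; Silverman AEC III.2.3, VII.2.2] [folklore] -/
theorem addX_identity_pointwise (h₁ : ‖t₁‖ < 1) (h₂ : ‖t₂‖ < 1) :
    t₁ * t₂ * (t₁ ^ 2 * padicEval V.formalXMulSq t₂ - t₂ ^ 2 * padicEval V.formalXMulSq t₁) *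
        (2 * t₁ ^ 2 * t₂ ^ 2 *
          (t₁ ^ 2 * padicEval V.formalXMulSq t₂ - t₂ ^ 2 * padicEval V.formalXMulSq t₁) ^ 2 *
          (padicEval V.formalXMulSq (padicEval₂ V.formalGroupLaw t₁ t₂) *
              padicEval₂ V.formalGroupLaw t₁ (padicEval V.formalNeg t₂) ^ 2 +
            padicEval V.formalXMulSq (padicEval₂ V.formalGroupLaw t₁ (padicEval V.formalNeg t₂)) *
              padicEval₂ V.formalGroupLaw t₁ t₂ ^ 2)) =
      t₁ * t₂ * (t₁ ^ 2 * padicEval V.formalXMulSq t₂ - t₂ ^ 2 * padicEval V.formalXMulSq t₁) *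
        (padicEval₂ V.formalGroupLaw t₁ t₂ ^ 2 *
          padicEval₂ V.formalGroupLaw t₁ (padicEval V.formalNeg t₂) ^ 2 *
          (((V.a₁ * t₁ - 2) * padicEval V.formalXMulSq t₁ + V.a₃ * t₁ ^ 3) ^ 2 * t₂ ^ 6 +
            ((V.a₁ * t₂ - 2) * padicEval V.formalXMulSq t₂ + V.a₃ * t₂ ^ 3) ^ 2 * t₁ ^ 6 -
            (V.b₂ * t₁ ^ 2 * t₂ ^ 2 + 4 * t₂ ^ 2 * padicEval V.formalXMulSq t₁ +
                4 * t₁ ^ 2 * padicEval V.formalXMulSq t₂) *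
              (t₁ ^ 2 * padicEval V.formalXMulSq t₂ - t₂ ^ 2 * padicEval V.formalXMulSq t₁) ^ 2)) := by
  -- `t₁ = 0` or `t₂ = 0`
  by_cases ht₁ : t₁ = 0
  · rw [ht₁]; ring
  by_cases ht₂ : t₂ = 0
  · rw [ht₂]; ring
  -- the points
  obtain ⟨P, hP, rfl⟩ := V.exists_isInReductionKernel_formalParameter_eq h₁
  obtain ⟨Q, hQ, rfl⟩ := V.exists_isInReductionKernel_formalParameter_eq h₂
  rcases P with _ | ⟨x₁, y₁, hP₁⟩
  · exact absurd rfl ht₁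
  rcases Q with _ | ⟨x₂, y₂, hQ₂⟩
  · exact absurd rfl ht₂
  have hx₁ : 1 < ‖x₁‖ := hP
  have hx₂ : 1 < ‖x₂‖ := hQ
  obtain ⟨hy₁, -, -, -, -⟩ := V.param_facts hP₁.1 hx₁
  obtain ⟨hy₂, -, -, -, -⟩ := V.param_facts hQ₂.1 hx₂
  rw [formalParameter_some, formalParameter_some] at *
  have hX₁ := V.padicEval_formalXMulSq_eq hP₁.1 hx₁
  have hX₂ := V.padicEval_formalXMulSq_eq hQ₂.1 hx₂
  -- `x₁ = x₂`: both sides vanish with `Δ̂`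
  by_cases hx : x₁ = x₂
  · have hΔ : (-x₁ / y₁) ^ 2 * padicEval V.formalXMulSq (-x₂ / y₂) -
        (-x₂ / y₂) ^ 2 * padicEval V.formalXMulSq (-x₁ / y₁) = 0 := by
      rw [hX₁, hX₂, hx]; ring
    rw [hΔ]; ring
  -- generic case: the sums `P ± Q`
  have hxy : ¬(x₁ = x₂ ∧ y₁ = V.toAffine.negY x₂ y₂) := fun h => hx h.1
  have hQn : V.toAffine.Nonsingular x₂ (V.toAffine.negY x₂ y₂) := (Affine.nonsingular_neg ..).mpr hQ₂
  have hxy' : ¬(x₁ = x₂ ∧ y₁ = V.toAffine.negY x₂ (V.toAffine.negY x₂ y₂)) := fun h => hx h.1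
  have hneg : padicEval V.formalNeg (-x₂ / y₂) = -x₂ / V.toAffine.negY x₂ y₂ :=
    V.padicEval_formalNeg_eq hQ₂.1 hx₂
  have hF : padicEval₂ V.formalGroupLaw (-x₁ / y₁) (-x₂ / y₂) =
      V.formalParameter (.some x₁ y₁ hP₁ + .some x₂ y₂ hQ₂) :=
    formalGroupLaw_padicEval_holds p V _ _ hP hQ
  have hFm : padicEval₂ V.formalGroupLaw (-x₁ / y₁) (-x₂ / V.toAffine.negY x₂ y₂) =
      V.formalParameter (.some x₁ y₁ hP₁ + .some x₂ (V.toAffine.negY x₂ y₂) hQn) :=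
    formalGroupLaw_padicEval_holds p V _ (.some x₂ _ hQn) hP hx₂
  rw [Affine.Point.add_some hxy, formalParameter_some] at hF
  rw [Affine.Point.add_some hxy', formalParameter_some] at hFm
  have hKp : 1 < ‖V.toAffine.addX x₁ x₂ (V.toAffine.slope x₁ x₂ y₁ y₂)‖ :=
    (padicEval₂_formalGroupLaw_of_not_neg_aux hP₁ hQ₂ hx₁ hx₂ hxy).1
  have hKm : 1 < ‖V.toAffine.addX x₁ x₂ (V.toAffine.slope x₁ x₂ y₁ (V.toAffine.negY x₂ y₂))‖ :=
    (padicEval₂_formalGroupLaw_of_not_neg_aux hP₁ hQn hx₁ hx₂ hxy').1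
  have hXF := V.padicEval_formalXMulSq_eq (Affine.nonsingular_add hP₁ hQ₂ hxy).1 hKp
  have hXFm := V.padicEval_formalXMulSq_eq (Affine.nonsingular_add hP₁ hQn hxy').1 hKm
  rw [hneg, hF, hFm, hXF, hXFm, hX₁, hX₂]
  -- the algebra
  have hFI := V.two_mul_sq_mul_addX_add_addX y₁ y₂ hx
  set xp := V.toAffine.addX x₁ x₂ (V.toAffine.slope x₁ x₂ y₁ y₂)
  set yp := V.toAffine.addY x₁ x₂ y₁ (V.toAffine.slope x₁ x₂ y₁ y₂)
  set xm := V.toAffine.addX x₁ x₂ (V.toAffine.slope x₁ x₂ y₁ (V.toAffine.negY x₂ y₂))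
  set ym := V.toAffine.addY x₁ x₂ y₁ (V.toAffine.slope x₁ x₂ y₁ (V.toAffine.negY x₂ y₂))
  set s₁ := -x₁ / y₁ with hs₁
  set s₂ := -x₂ / y₂ with hs₂
  set zp := -xp / yp
  set zm := -xm / ym
  have ht₁ : s₁ * y₁ = -x₁ := by rw [hs₁]; field_simp
  have ht₂ : s₂ * y₂ = -x₂ := by rw [hs₂]; field_simp
  linear_combination
    (s₁ * s₂ * (s₁ ^ 2 * (x₂ * s₂ ^ 2) - s₂ ^ 2 * (x₁ * s₁ ^ 2)) * zp ^ 2 * zm ^ 2 *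
      s₁ ^ 6 * s₂ ^ 6) * hFI +
    (-4 * s₁ * s₂ * (s₁ ^ 2 * (x₂ * s₂ ^ 2) - s₂ ^ 2 * (x₁ * s₁ ^ 2)) * zp ^ 2 * zm ^ 2 *
      s₂ ^ 6 * s₁ ^ 4 * ((s₁ * y₁ + x₁) - s₁ * (2 * y₁ + V.a₁ * x₁ + V.a₃))) * ht₁ +
    (-4 * s₁ * s₂ * (s₁ ^ 2 * (x₂ * s₂ ^ 2) - s₂ ^ 2 * (x₁ * s₁ ^ 2)) * zp ^ 2 * zm ^ 2 *
      s₁ ^ 6 * s₂ ^ 4 * ((s₂ * y₂ + x₂) - s₂ * (2 * y₂ + V.a₁ * x₂ + V.a₃))) * ht₂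

end Pointwise

/-! ### The formal identity -/

section Formal

variable {p : ℕ} [Fact p.Prime] (V : WeierstrassCurve ℚ_[p]) [hV : V.IsIntegral ℤ_[p]]

/-- `Δ = u²X(v) - v²X(u) ≠ 0` (its value at `(p, 0)` is `p²`). [folklore] -/
theorem formalDelta_ne_zero :
    (MvPowerSeries.X 0 : MvPowerSeries (Fin 2) ℚ_[p]) ^ 2 *
        V.formalXMulSq.subst (MvPowerSeries.X 1 : MvPowerSeries (Fin 2) ℚ_[p]) -
      (MvPowerSeries.X 1 : MvPowerSeries (Fin 2) ℚ_[p]) ^ 2 *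
        V.formalXMulSq.subst (MvPowerSeries.X 0 : MvPowerSeries (Fin 2) ℚ_[p]) ≠ 0 := by
  intro h
  have hp : ‖(p : ℚ_[p])‖ < 1 := Padic.norm_p_lt_one
  have h0 : ‖(0 : ℚ_[p])‖ < 1 := by rw [norm_zero]; exact one_pos
  have hev := padicEval₂_formalDelta (V := V) hp h0
  rw [h, ← map_zero (MvPowerSeries.C (σ := Fin 2) (R := ℚ_[p])), padicEval₂_C, padicEval_zero_right,
    V.constantCoeff_formalXMulSq] at hev
  have hp0 : (p : ℚ_[p]) ≠ 0 := Nat.cast_ne_zero.mpr (Fact.out : p.Prime).ne_zero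
  apply hp0
  have : (p : ℚ_[p]) ^ 2 = 0 := by linear_combination -hev
  exact pow_eq_zero_iff (n := 2) (by norm_num) |>.mp this

/-- `u ≠ 0`, `v ≠ 0` in `ℚ_p⟦u, v⟧`. [folklore] -/
theorem mvPowerSeries_X_ne_zero (i : Fin 2) : (MvPowerSeries.X i : MvPowerSeries (Fin 2) ℚ_[p]) ≠ 0 := by
  intro h
  have := congrArg (MvPowerSeries.coeff (Finsupp.single i 1)) h
  rw [MvPowerSeries.coeff_X, if_pos rfl, map_zero] at this
  exact one_ne_zero this

/-- **The addition formula for `x` on the formal group, as a formal identity** (the group-law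
content of Blakestad–Grant's Lemma 10): in `ℚ_p⟦u, v⟧`, with `X = z²x(z)`,
`Ỹ = (a₁z - 2)X + a₃z³ = z³(2y + a₁x + a₃)`, `Δ = u²X(v) - v²X(u)`, `F = u +_F v`, `Fm = u -_F v`:
`2u²v²Δ²·(X(F)·Fm² + X(Fm)·F²) = F²Fm²·(Ỹ(u)²v⁶ + Ỹ(v)²u⁶ - (b₂u²v² + 4v²X(u) + 4u²X(v))·Δ²)`,
i.e. `x(u +_F v) + x(u -_F v) = (Y(u)² + Y(v)²)/(2(x(u) - x(v))²) - b₂/2 - 2(x(u) + x(v))` with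
all poles cleared — from the identity at points by the identity theorem.
[Blakestad–Grant 2023, Lemma 10 ("follows readily from the group law on `E/K`");
Silverman AEC III.2.3] [folklore] -/
theorem formalGroupLaw_addX_identity [V.IsElliptic] :
    2 * (MvPowerSeries.X 0 : MvPowerSeries (Fin 2) ℚ_[p]) ^ 2 *
      (MvPowerSeries.X 1 : MvPowerSeries (Fin 2) ℚ_[p]) ^ 2 *
      ((MvPowerSeries.X 0 : MvPowerSeries (Fin 2) ℚ_[p]) ^ 2 *
          V.formalXMulSq.subst (MvPowerSeries.X 1 : MvPowerSeries (Fin 2) ℚ_[p]) -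
        (MvPowerSeries.X 1 : MvPowerSeries (Fin 2) ℚ_[p]) ^ 2 *
          V.formalXMulSq.subst (MvPowerSeries.X 0 : MvPowerSeries (Fin 2) ℚ_[p])) ^ 2 *
      (V.formalXMulSq.subst V.formalGroupLaw * V.formalGroupLawSub ^ 2 +
        V.formalXMulSq.subst V.formalGroupLawSub * V.formalGroupLaw ^ 2) =
    V.formalGroupLaw ^ 2 * V.formalGroupLawSub ^ 2 *
      (((MvPowerSeries.C V.a₁ * MvPowerSeries.X 0 - 2) *
            V.formalXMulSq.subst (MvPowerSeries.X 0 : MvPowerSeries (Fin 2) ℚ_[p]) +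
          MvPowerSeries.C V.a₃ * (MvPowerSeries.X 0) ^ 3) ^ 2 *
          (MvPowerSeries.X 1 : MvPowerSeries (Fin 2) ℚ_[p]) ^ 6 +
        ((MvPowerSeries.C V.a₁ * MvPowerSeries.X 1 - 2) *
            V.formalXMulSq.subst (MvPowerSeries.X 1 : MvPowerSeries (Fin 2) ℚ_[p]) +
          MvPowerSeries.C V.a₃ * (MvPowerSeries.X 1) ^ 3) ^ 2 *
          (MvPowerSeries.X 0 : MvPowerSeries (Fin 2) ℚ_[p]) ^ 6 -
        (MvPowerSeries.C V.b₂ * (MvPowerSeries.X 0 : MvPowerSeries (Fin 2) ℚ_[p]) ^ 2 *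
              (MvPowerSeries.X 1 : MvPowerSeries (Fin 2) ℚ_[p]) ^ 2 +
            4 * (MvPowerSeries.X 1 : MvPowerSeries (Fin 2) ℚ_[p]) ^ 2 *
              V.formalXMulSq.subst (MvPowerSeries.X 0 : MvPowerSeries (Fin 2) ℚ_[p]) +
          4 * (MvPowerSeries.X 0 : MvPowerSeries (Fin 2) ℚ_[p]) ^ 2 *
              V.formalXMulSq.subst (MvPowerSeries.X 1 : MvPowerSeries (Fin 2) ℚ_[p])) *
        ((MvPowerSeries.X 0 : MvPowerSeries (Fin 2) ℚ_[p]) ^ 2 *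
            V.formalXMulSq.subst (MvPowerSeries.X 1 : MvPowerSeries (Fin 2) ℚ_[p]) -
          (MvPowerSeries.X 1 : MvPowerSeries (Fin 2) ℚ_[p]) ^ 2 *
            V.formalXMulSq.subst (MvPowerSeries.X 0 : MvPowerSeries (Fin 2) ℚ_[p])) ^ 2) := by
  set u := (MvPowerSeries.X 0 : MvPowerSeries (Fin 2) ℚ_[p]) with hu
  set v := (MvPowerSeries.X 1 : MvPowerSeries (Fin 2) ℚ_[p]) with hv
  set Δ := u ^ 2 * V.formalXMulSq.subst v - v ^ 2 * V.formalXMulSq.subst u with hΔ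
  have hL := V.isPadicInt_addXLHS
  have hR := V.isPadicInt_addXRHS
  have hΔi := V.isPadicInt_formalDelta
  rw [← hu, ← hv, ← hΔ] at hL hR hΔi
  have huvΔ : IsPadicInt (u * v * Δ) := ((IsPadicInt.X 0).mul (IsPadicInt.X 1)).mul hΔi
  -- cancel `u·v·Δ`
  have hne : u * v * Δ ≠ 0 :=
    mul_ne_zero (mul_ne_zero (mvPowerSeries_X_ne_zero 0) (mvPowerSeries_X_ne_zero 1))
      V.formalDelta_ne_zero
  refine mul_left_cancel₀ hne ?_
  -- identity theorem
  refine eq_of_padicEvalMv_eq (huvΔ.mul hL) (huvΔ.mul hR) fun pt hpt => ?_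
  have hpt' : pt = ![pt 0, pt 1] := by funext i; fin_cases i <;> rfl
  rw [hpt', ← padicEval₂_eq_padicEvalMv, ← padicEval₂_eq_padicEvalMv,
    padicEval₂_mul huvΔ hL (hpt 0) (hpt 1), padicEval₂_mul huvΔ hR (hpt 0) (hpt 1),
    padicEval₂_mul ((IsPadicInt.X 0).mul (IsPadicInt.X 1)) hΔi (hpt 0) (hpt 1),
    padicEval₂_mul (IsPadicInt.X 0) (IsPadicInt.X 1) (hpt 0) (hpt 1), hu, hv, padicEval₂_X,
    padicEval₂_X, hΔ, padicEval₂_formalDelta (hpt 0) (hpt 1), padicEval₂_addXLHS (hpt 0) (hpt 1),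
    padicEval₂_addXRHS (hpt 0) (hpt 1)]
  exact addX_identity_pointwise (hpt 0) (hpt 1)

end Formal

end WeierstrassCurve
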